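import Summits.HodgeConjecture.HodgeConjecture.Theses.CurveNetMordellWeil
import Literature.AlgebraicGeometry.HodgeTheory.SaitoGrFDeRhamCurveNet
import Literature.AlgebraicGeometry.HodgeTheory.NodalDivisor
import Literature.AlgebraicGeometry.HodgeTheory.VanishingCohomologyNontrivialProofs
import Literature.AlgebraicGeometry.Motives.CurveNet
import Literature.AlgebraicGeometry.HodgeTheory.GysinFormalismPushforward
import Literature.AlgebraicGeometry.Motives.FiberNetExistence

/-!
# Line `tangential-carriers-period-syzygies` — skeleton for crux `CurveNetMordellWeil.VerticalSupportMiddle`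
(item stmt-HodgeConjecture-2782, route route-HodgeConjecture-CurveNetMordellWeil; crux-plan round 1 for the idea card
`Cruxes/VerticalSupportMiddle/Ideas/tangential-carriers-period-syzygies.md`; triage r1-1/r1-2: **pass / pass**;
planner-cruxplan-stmt-HodgeConjecture-2782-tangential-carriers--0, 2026-08-16)

Crux (AS TYPED, ∀ surjective `pr`): `X` smooth projective of dimension `2q ≥ 4`, `pr : X ⟶ ℙ^{2q-1}` surjective:
the `ℂ`-span of the rational `(q,q)`-classes lies in `algebraicClasses X q ⊔ span{rational (q,q)-classes dying off
pr⁻¹T, T ⊊ ℙ^{2q-1} Zariski-closed}`.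

## The line in one paragraph

Two artefacts of the typing are isolated first; then the card's lever is stated on honest curve nets over the REAL
carrier `vert N F k = classesSupportedOn N.total (π⁻¹V(F)) k` (never over an abstract `CurveNetSaitoData`: by
`curveNetSaitoData_nonempty_iff_anchor` that package is only an anchor, and over admissible hypersurfaces its
`ihSupported` IS this carrier through `ker_rho`).
* STUB 1 `stub_oddConiveauOne` — rational `(p,p)`-classes on smooth projective `(2p+1)`-folds have coniveau `≥ 1`
  (`p ≥ 1`). This is where the Stein artefact of the `∀ surjective pr` typing lives and NOWHERE ELSE: it is literally
  the conclusion of the landed `Theorems.verticalSupportMiddle_imp_coniveau_one_odd` (crux ⟹ stub 1, see the note in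
  §4), so any proof of the crux proves it; inside the route's `closes` it is the
  induction hypothesis `HC(q-1)` read through Deligne descent (free there; HC-hard standalone for `p ≥ 2`, Lefschetz
  `(1,1)` at `p = 1`). Planner-facing recommendation (every seat so far): restate 2782 over `Motives.CurveNet` / with
  the antecedent `∀ q' < q, HC q'`; this skeleton is shaped so that such a restatement deletes stub 1 and nothing else.
* STUB 2 `stub_steinFreeTransfer` — Transfer `C⁺ ⟹ crux-shape`: verticality on honest nets (`NetVerticality`) plus
  stub 1 give pointwise verticality for EVERY surjective `pr` (`GeneralVerticality`). Stein factorisation is avoided: a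
  `2q`-fold `X'` carries a curve net `N` (`nonempty_curveNet`); `σ^* c` is vertical on `N.total`, so
  `c = t⁻¹ σ_* σ^* c` is supported on a proper closed subset (blow-down transfer, PROVED in
  `CurveNetMordellWeilCurveNetExistsTransfer`); Deligne descent (`Deligne1974_…`,
  `Voisin2025_hodgeClass_lift_complexGysin`) writes it as Gysin images of Hodge classes on `(2q-1)`-folds dominating
  `ℙ^{2q-1}` (or on varieties with proper image); stub 1 makes those `β ∈ N¹`, and a proper closed subset of a
  `(2q-1)`-fold has proper image in `ℙ^{2q-1}`. TRUE in print; size L; tree-blocked on the two named facts.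
* STUB 3 `stub_tangentialCarrierLaw` — THE LEVER (hardest; open; crux-on-nets strength PLUS structure): every
  rational `(q,q)`-class `c` on the total space `X̃` of a curve net is either Δ-VERTICAL (supported over an admissible
  hypersurface `V(F₀) ⊇ Δ`) or vertical over `V(F₀·G)` where `V(G)` is a TANGENTIAL CARRIER with `k ≥ 1`
  CHARACTERISTIC POINTS: the image of a smooth proper `(m-1)`-fold `ν : S ⟶ ℙᵐ` (the normalised carrier — for
  `q = 2` and a cycle `Z`, `S = Z` itself with `ν = π|_Z`, cf. the card's "P is a SECTION over the plane π(P)"; in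
  general a resolution of the carrier hypersurface, which for `q ≥ 3` is generically singular along a curve) whose
  fibre product `X̃ ×_{ℙᵐ} S` (the vertical divisor seen on the carrier) has exactly `k` singular points, all isolated
  — the points where `ν` is tangent to the image of `dπ` at a critical point of `π`, i.e. to the discriminant (card
  §Lever, Lefschetz model `{xy = f(t')}`; the forced ones are `Z ∩ N`, `N` the node locus, `k_Z = Z·[N]`). Isolated
  rather than "ordinary double" because the law quantifies over ALL nets, not only Lefschetz-generic ones (Morse
  contact is generic, not universal); normalised rather than embedded so that the classes obeying the law form a
  `ℚ`-subspace (disjoint union of carriers, product of equations) and contain every cycle class granted HC.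
* STUB 4 `stub_genericCarriersAddNothing` — B5 (ideator-1, re-derived by both triagers): for an admissible `F₀ ≠ 0`
  and a GENERIC form `G` of any degree `e ≥ 1`, `vert(F₀·G) = vert(F₀)` (Thom–Gysin for `R¹π_*` on the affine
  `ℙᵐ ∖ V(F₀)`, strictness of weights, Lefschetz hyperplane for `IC(R¹π_*)` in degree `m-2`, `Gysin∘res = e·h ∪`,
  `h = 0` off `V(F₀)`). "Generic" is typed honestly: outside the zero set of ONE polynomial `Φ` in the coefficients,
  non-vacuous on degree-`e` forms. TRUE in print; L; tree-blocked on IC-Lefschetz / decomposition over the base.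
* STUB 5 `stub_defectNodeBound` — the defect bound for EMBEDDED NODAL carriers (`V(G)` with `π⁻¹V(G)` a `k`-nodal
  divisor of `X̃` — then `V(G)` is smooth and this is the normalised carrier `ν = V(G) ↪ ℙᵐ` with ODP characteristic
  points; the calibration case `V(G)` = the plane `π(P)` of a cubic fourfold, `k = 4`, `σ = 1`):
  `finrank vert(F₀·G) ≤ finrank vert(F₀) + k` (new classes come from `H_{2q}(W) = H_{2q}(W') ⊕ R`,
  `R = ker(ℚᵏ → H_{2q-1}(W'))` the relations among the vanishing spheres of a generic smoothing `W' = π⁻¹V(G')` in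
  `|π^*𝒪(e)|`, `dim R = σ ≤ k`; exceptional quadrics of the blow-up of the nodes push to `0` in `H^{2q}(X̃)`; `W'` adds
  nothing by stub 4). `k = 0`: SMOOTH vertical divisors add nothing. TRUE in print (Clemens 1983; Cynk 2001 Thm 1 /
  Rams arXiv:math/0702114 §1 for why the AMPLE-ambient adjoint formula must not be transplanted — it predicts `σ = 4`
  for the plane, truth `1`); L; tree-blocked on vanishing cycles of vertical degenerations.
`VerticalSupportMiddle_of` composes stubs 1–3 (kernel-checked, no `sorry`) and concludes the crux BY NAME; stub 4 is
consumed by `carriersOfNewClasses_not_generic` (the card's LOCALISATION THEOREM: carriers of new vertical classes are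
non-generic, i.e. characteristic) and stub 5 by `vert_mul_eq_of_smooth_carrier` / `finrank_newVertical_le` (the defect
inequality; `k = 0` ⟹ nothing new), all PROVED here.

## Stubs (5) · hardest: `stub_tangentialCarrierLaw`
`stub_oddConiveauOne` (XL, open = HC(q-1) on odd-dimensional varieties; necessary) · `stub_steinFreeTransfer` (L, in
print, tree-blocked) · `stub_tangentialCarrierLaw` (XL, open, THE LEVER) · `stub_genericCarriersAddNothing` (L, in
print) · `stub_defectNodeBound` (L, in print).

## Disproof.lean obligations honoured
NONE EXIST: payload `disproof_path` (refuter-cdisprove-stmt-HodgeConjecture-2782-0/Disproof.lean) and the publish path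
`Cruxes/VerticalSupportMiddle/Disproof.lean` are absent on this hub (`ledger crux ls` lists no Disproof.lean); no
`_false_without_<H>` theorem, tightness lemma, refuted strengthening, `-- Targets` kill or landed
`Theorems/VerticalSupportMiddle/Negative/*` lemma exists. The one landed constraint on the crux is the hardness file
`Theorems/CurveNetMordellWeilVerticalSupportMiddleHardness.lean` (crux ⟹ coniveau one on odd-dimensional varieties;
crux at `q = 3` ⟹ HC for fourfolds): honoured by stub 1 (note in §4: "the line uses H = OddConiveauOne at stub 1,
consumed once by stub 2"). No stub restates the crux (stub 3 lives on `Motives.CurveNet` and asserts the carrier dichotomy; stub 1 is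
strictly weaker than the crux and kernel-checked necessary), the summit, a route item, or a statement of the negatives
index (2 unrelated entries: Fermat multisets, 22×22 `E`-line matrix). Dead line `Sketch` (detection = crux in dual
clothes) is avoided: no stub is a duality / detection / NL-jump reformulation; the composition is transfer + existence
of a tangential carrier, not linear algebra on `H^{2q}`.
-/

noncomputable section

set_option linter.dupNamespace false

namespace Summit.HodgeConjecture.HodgeConjecture.Cruxes.VerticalSupportMiddle.TangentialCarriersPeriodSyzygies

open CategoryTheory CategoryTheory.Limits AlgebraicGeometry
open Literature.AlgebraicGeometry Literature.AlgebraicGeometry.Motives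
  Literature.AlgebraicGeometry.HodgeTheory Literature.AlgebraicTopology.SingularHomology
open Summit.HodgeConjecture.HodgeConjecture.Theses.CurveNetMordellWeil (VerticalSupportMiddle)

/-! ### §0 Vocabulary on the real carriers -/

section Vocabulary

variable {m : ℕ} {X : SchemeOver ℂ}

/-- **Vertical classes over the hypersurface `V(F)`**: the classes of `Hᵏ(X̃(ℂ); ℂ)` supported on
`π⁻¹V(F)`, i.e. dying on the complex points over `X̃ ∖ π⁻¹V(F)` — the real carrier
`classesSupportedOn` of the tree (for admissible `F` this is `ker ρ_F` of any `CurveNetSaitoData`, `ker_rho`). -/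
abbrev vert (N : CurveNet m X) (F : MvPolynomial (Fin (m + 1)) ℂ) (k : ℕ) :
    Submodule ℂ (complexBetti N.total k) :=
  classesSupportedOn N.total (N.proj.left.base ⁻¹' projHypersurface m F) k

/-- `V(F) ⊆ V(F·G)`, so vertical classes over `V(F)` are vertical over `V(F·G)`. -/
theorem vert_le_vert_mul (N : CurveNet m X) (F G : MvPolynomial (Fin (m + 1)) ℂ) (k : ℕ) :
    vert N F k ≤ vert N (F * G) k :=
  classesSupportedOn_mono (Set.preimage_mono (projHypersurface_subset_mul m F G)) k

/-- **Evaluation of a polynomial in the coefficients at a form**: `Φ(G)` for `Φ ∈ ℂ[a_d | d ∈ ℕ^{m+1}]` a polynomial in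
(finitely many of) the coefficient variables `a_d` and `G ∈ ℂ[x₀,…,xₘ]` — used to say "`G` generic of degree `e`"
as "`Φ(G) ≠ 0` for one fixed `Φ` not vanishing identically on degree-`e` forms" (a non-empty basic Zariski-open
subset of the affine space `H⁰(ℙᵐ, 𝒪(e))`). -/
abbrev coeffEval (Φ : MvPolynomial (Fin (m + 1) →₀ ℕ) ℂ) (G : MvPolynomial (Fin (m + 1)) ℂ) : ℂ :=
  MvPolynomial.eval (fun d : Fin (m + 1) →₀ ℕ => MvPolynomial.coeff d G) Φ

/-- **Isolated singularities**: the scheme `W` has exactly `k` non-regular points, each a closed point (for `W` of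
finite type over `ℂ`: `k` isolated singular points and smooth elsewhere). The last clauses of `IsNodalDivisor`
without the ODP requirement. -/
def HasIsolatedSingularities (k : ℕ) (W : Scheme) : Prop :=
  ∃ S : Finset W, S.card = k ∧ (∀ x : W, x ∈ S ↔ ¬ IsRegularLocalRing (W.presheaf.stalk x)) ∧
    ∀ x ∈ S, IsClosed ({x} : Set W)

/-- **`V(G)` is a tangential carrier for the net `N` with `k` characteristic points** (normalised form): there is a
smooth proper `ℂ`-scheme `S` of pure dimension `m - 1` (possibly disconnected) with a morphism `ν : S ⟶ ℙᵐ` whose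
image is exactly the hypersurface `V(G)` (so `ν` is generically finite onto it), such that the vertical divisor read
on the carrier, the fibre product `X̃ ×_{ℙᵐ} S`, has exactly `k` singular points, all isolated. Those are the pairs
(critical point `x` of `π`, `s`) with `π x = ν s` and `im dν_s ⊆ im dπ_x`: the points where the carrier is TANGENT
to the discriminant (for a Lefschetz critical point `im dπ_x = T_{π x}Δ`; local model `{xy = f(t')}`, singular
since `f(0) = 0`, `df(0) = 0`, an ODP iff `f` is Morse). `k = 0` = a carrier transverse to `dπ` everywhere. For
`q = 2` and a surface `Z ⊆ X̃` the intended carrier is `S = Z`, `ν = π|_Z` (its forced characteristic points are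
`Z ∩ N`, `N` the node locus of `π`); for an embedded smooth `V(G)` with nodal `π⁻¹V(G)` it is `ν = V(G) ↪ ℙᵐ`. -/
def IsTangentialCarrier (N : CurveNet m X) (G : MvPolynomial (Fin (m + 1)) ℂ) (k : ℕ) : Prop :=
  ∃ (S : SchemeOver ℂ) (ν : S ⟶ projectiveSpace m ℂ),
    SmoothOfRelativeDimension (m - 1) S.hom ∧ IsProper S.hom ∧
    Set.range ν.left.base = projHypersurface m G ∧
    HasIsolatedSingularities k (pullback N.proj.left ν.left)

/-- **`V(G)` is an embedded NODAL carrier with `k` nodes**: the closed set `π⁻¹V(G) ⊆ X̃` underlies a `k`-nodal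
divisor of `X̃` of dimension `m` (`IsNodalDivisor`: a reduced effective Cartier divisor whose only singularities are
`k` ordinary double points). Then `V(G)` is smooth off `Δ`-invisible components (a singular point of `V(G)` over
which `π` is smooth makes the whole fibre curve singular in `π⁻¹V(G)`), the nodes are critical points of `π` at
which `V(G)` is tangent to `im dπ`, and `k = 0` means the vertical divisor is smooth. The calibration carriers
(the plane of a cubic fourfold: `k = 4`) are of this kind. -/
def IsNodalCarrier (N : CurveNet m X) (G : MvPolynomial (Fin (m + 1)) ℂ) (k : ℕ) : Prop :=
  ∃ (D : SchemeOver ℂ) (ι : D ⟶ N.total), IsNodalDivisor m k ι ∧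
    HodgeTheory.support ι = N.proj.left.base ⁻¹' projHypersurface m G

end Vocabulary

/-! ### §1 The five statements -/

/-- **Statement 1 — coniveau one below the middle on odd-dimensional varieties.** Every rational `(p,p)`-class on a
smooth projective complex variety of dimension `2p + 1`, `p ≥ 1`, lies in `N¹H²ᵖ` (dies off a proper Zariski-closed
subset). VERBATIM the conclusion of `Theorems.verticalSupportMiddle_imp_coniveau_one_odd` (crux ⟹ this). -/
def OddConiveauOne : Prop :=
  ∀ ⦃p : ℕ⦄ ⦃B : SchemeOver ℂ⦄, 1 ≤ p → IsSmoothProjective (2 * p + 1) B →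
    ∀ c : complexBetti B (2 * p), IsRationalClass c → IsOfHodgeType (2 * p + 1) B (2 * p) p p c →
      c ∈ supportedClasses B (2 * p) 1

/-- **Statement C⁺ — vertical support on honest curve nets** (the card's Transfer target): for a curve net
`N : Motives.CurveNet m X` over `ℂ` (connected curve fibres, total space `X̃ = N.total` smooth projective of dimension
`m + 1 = 2q`, `q ≥ 2`), every rational `(q,q)`-class on `X̃` is supported on `π⁻¹V(F)` for ONE non-zero form `F`
(pointwise, single-hypersurface form; the `algebraicClasses` summand of the crux is redundant for `q ≥ 2`). -/
def NetVerticality : Prop :=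
  ∀ ⦃q m : ℕ⦄ ⦃X : SchemeOver ℂ⦄ (N : CurveNet m X), 2 ≤ q → m + 1 = 2 * q →
    ∀ c : complexBetti N.total (2 * q), IsRationalClass c → IsOfHodgeType (m + 1) N.total (2 * q) q q c →
      ∃ F : MvPolynomial (Fin (m + 1)) ℂ, F ≠ 0 ∧ c ∈ vert N F (2 * q)

/-- **Statement — vertical support for every surjective `pr`, pointwise** (the crux without its redundant algebraic
summand, one class at a time): the shape the transfer delivers and `VerticalSupportMiddle_of` consumes. -/
def GeneralVerticality : Prop :=
  ∀ ⦃q m : ℕ⦄ ⦃X : SchemeOver ℂ⦄ (pr : X ⟶ projectiveSpace m ℂ), IsSmoothProjective (2 * q) X → 2 ≤ q →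
    m + 1 = 2 * q → Function.Surjective pr.left.base →
      ∀ c : complexBetti X (2 * q), IsRationalClass c → IsOfHodgeType (2 * q) X (2 * q) q q c →
        ∃ T : Set (projectiveSpace m ℂ).left, IsClosed T ∧ T ≠ Set.univ ∧
          complexBetti.restrictCompl X (pr.left.base ⁻¹' T) (2 * q) c = 0

/-- **Statement 2 — the Stein-free transfer**: coniveau one on odd-dimensional varieties and vertical support on
honest curve nets imply vertical support for every surjective `pr : X^{2q} ⟶ ℙ^{2q-1}`. -/
def SteinFreeTransfer : Prop :=
  OddConiveauOne → NetVerticality → GeneralVerticality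

/-- **Statement 3 — THE TANGENTIAL-CARRIER LAW (the lever).** For a curve net `N` (`m + 1 = 2q`, `q ≥ 2`) and a
rational `(q,q)`-class `c` on `X̃`: there is a non-zero admissible form `F₀` (`Δ ⊆ V(F₀)`) such that EITHER `c` is
Δ-vertical, `c ∈ vert(F₀)`, OR there is a non-zero form `G` of degree `e ≥ 1` such that `V(G)` is a tangential
carrier with `k ≥ 1` characteristic points (`IsTangentialCarrier`) and `c ∈ vert(F₀·G)`. -/
def TangentialCarrierLaw : Prop :=
  ∀ ⦃q m : ℕ⦄ ⦃X : SchemeOver ℂ⦄ (N : CurveNet m X), 2 ≤ q → m + 1 = 2 * q →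
    ∀ c : complexBetti N.total (2 * q), IsRationalClass c → IsOfHodgeType (m + 1) N.total (2 * q) q q c →
      ∃ F₀ : MvPolynomial (Fin (m + 1)) ℂ, F₀ ≠ 0 ∧ N.IsAdmissibleForm F₀ ∧
        (c ∈ vert N F₀ (2 * q) ∨
          ∃ (G : MvPolynomial (Fin (m + 1)) ℂ) (e k : ℕ), 1 ≤ e ∧ G.IsHomogeneous e ∧ G ≠ 0 ∧ 1 ≤ k ∧
            IsTangentialCarrier N G k ∧ c ∈ vert N (F₀ * G) (2 * q))

/-- **Statement 4 — generic carriers add nothing (B5).** For a curve net `N` (`m + 1 = 2q`, `q ≥ 2`), a non-zero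
admissible form `F₀` and a degree `e ≥ 1` there is a polynomial `Φ` in the coefficients, not vanishing at some
form of degree `e`, such that every form `G` of degree `e` with `Φ(G) ≠ 0` satisfies `vert(F₀·G) = vert(F₀)`. -/
def GenericCarriersAddNothing : Prop :=
  ∀ ⦃q m : ℕ⦄ ⦃X : SchemeOver ℂ⦄ (N : CurveNet m X), 2 ≤ q → m + 1 = 2 * q →
    ∀ (F₀ : MvPolynomial (Fin (m + 1)) ℂ) (e : ℕ), N.IsAdmissibleForm F₀ → F₀ ≠ 0 → 1 ≤ e →
      ∃ Φ : MvPolynomial (Fin (m + 1) →₀ ℕ) ℂ,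
        (∃ G₀ : MvPolynomial (Fin (m + 1)) ℂ, G₀.IsHomogeneous e ∧ coeffEval Φ G₀ ≠ 0) ∧
        ∀ G : MvPolynomial (Fin (m + 1)) ℂ, G.IsHomogeneous e → coeffEval Φ G ≠ 0 →
          vert N (F₀ * G) (2 * q) = vert N F₀ (2 * q)

/-- **Statement 5 — the defect bound.** For a curve net `N` (`m + 1 = 2q`, `q ≥ 2`), a non-zero admissible `F₀`
and a form `G` of degree `e ≥ 1` whose vertical divisor `π⁻¹V(G)` is a `k`-nodal divisor of `X̃`: the vertical
classes over `V(F₀·G)` exceed those over `V(F₀)` by at most `k` dimensions (Clemens: new classes = relations among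
the `k` vanishing spheres, `σ ≤ k`; `k = 0`: nothing new). -/
def DefectNodeBound : Prop :=
  ∀ ⦃q m : ℕ⦄ ⦃X : SchemeOver ℂ⦄ (N : CurveNet m X), 2 ≤ q → m + 1 = 2 * q →
    ∀ (F₀ G : MvPolynomial (Fin (m + 1)) ℂ) (e k : ℕ), N.IsAdmissibleForm F₀ → F₀ ≠ 0 → 1 ≤ e →
      G.IsHomogeneous e → IsNodalCarrier N G k →
        Module.finrank ℂ ↥(vert N (F₀ * G) (2 * q)) ≤ Module.finrank ℂ ↥(vert N F₀ (2 * q)) + k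

/-! ### §2 The registered stubs -/

/-- **STUB 1 — coniveau one below the middle on odd-dimensional varieties (XL; OPEN for `p ≥ 2`, = Lefschetz `(1,1)`
at `p = 1`; NECESSARY).** WHY PLAUSIBLY TRUE: it is implied by the Hodge conjecture in codimension `p` (an algebraic
class has coniveau `p ≥ 1`), and conversely by Deligne descent it is "HC(p) on `(2p+1)`-folds modulo HC in lower
codimension"; inside the route's deciding theorem `closes` (strong induction on the codimension) it is available at
stage `q = p + 1` as the induction hypothesis, so a planner restating 2782 with the antecedent `∀ q' < q, HC q'` (or
over `Motives.CurveNet`) deletes this stub. WHY IT MIGHT FAIL: only with HC itself. WHY IT IS HERE: the crux as typed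
quantifies over every surjective `pr`, and `Theorems.verticalSupportMiddle_imp_coniveau_one_odd` (p103054, kernel-
checked; see the note in §4) shows the crux IMPLIES it — the `B × ℙ¹ ⟶ B ⟶ ℙ^{2p+1}` disconnected-fibre instance — so
no line can avoid it; this skeleton confines it to one named stub consumed once, by the transfer (stub 2).
LEANS ON (to state): `supportedClasses` only. -/
theorem stub_oddConiveauOne : OddConiveauOne := by
  sorry

/-- **STUB 2 — the Stein-free transfer (L; TRUE IN PRINT; tree-blocked on two named facts).** `OddConiveauOne →
NetVerticality → GeneralVerticality`. PROOF IN PRINT. Let `pr : X' ⟶ ℙᵐ` be surjective, `X'` smooth projective of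
dimension `2q = m + 1 ≥ 4`, `c` a rational `(q,q)`-class. (i) `X'` carries a curve net `N : CurveNet m X'`
(`Motives.nonempty_curveNet`, named fact: generic linear projection + blow-up, Hartshorne II 7.17.3 + Bertini +
Fulton–Hansen); `σ^* c` is a rational `(q,q)`-class on `N.total` (Hodge models: `nonempty_hodgeModel_holds`, PROVED;
rewrite the dimension index along `m + 1 = 2q`), so by `NetVerticality` it is supported on `W = N.proj⁻¹V(F)`,
`F ≠ 0`; `c = t⁻¹ · σ_* σ^* c` (`t ≠ 0`, `span_hodgeClasses_le_map_complexGysin_blowDown`, PROVED) is supported on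
the closed set `σ(W)` (Gysin maps are compatible with supports: `complexGysin_restrictCompl_eq_zero`, PROVED), and
`σ(W) ≠ X'` (`W ≠ X̃` because `π` is onto and `V(F) ≠ ℙᵐ`, `projHypersurface_ne_univ`; `σ` is birational and `X̃`
irreducible), i.e. `c ∈ N¹H^{2q}(X')`. (ii) Deligne descent (`Deligne1974_ker_restrictCompl_eq_iSup_range_complexGysin`
+ the Hodge lift `Voisin2025_hodgeClass_lift_complexGysin`, named facts; pattern of
`Theorems.supportedHodgeClass_mem_algebraicClasses_of_codim_lt`) writes `c = Σⱼ gⱼ_* βⱼ` with `βⱼ` rational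
`(q-e, q-e)`-classes on smooth projective `Yⱼ` of dimension `2q - e`, `e ≥ 1` (resolutions of the components of the
support, Hironaka — PROVED instance `Hironaka1964_projective_holds`). (iii) If `pr(gⱼ(Yⱼ)) ≠ ℙᵐ` (always when
`e ≥ 2`: dimension `≤ 2q - 2 < m`), `gⱼ_* βⱼ` dies off `pr⁻¹` of that proper closed image. If `e = 1` and `Yⱼ`
dominates `ℙᵐ`, then `dim Yⱼ = 2q - 1 = 2(q-1) + 1` and `βⱼ ∈ Hdg^{q-1}(Yⱼ)`: by `OddConiveauOne` (`p = q - 1 ≥ 1`)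
`βⱼ` dies off a proper closed `Zⱼ ⊊ Yⱼ`, whose image under the generically finite `pr ∘ gⱼ` is a proper closed
subset of `ℙᵐ` (dimension theory: `one_le_coheight_of_mem_of_isClosed` and its relatives); hence `gⱼ_* βⱼ` dies off
`pr⁻¹(closure pr gⱼ Zⱼ)`. (iv) A finite union of proper closed subsets of the irreducible `ℙᵐ` is proper closed;
`c` dies off `pr⁻¹` of it. WHY IT MIGHT FAIL: it does not as mathematics (bookkeeping over catalogued facts); the
risk is formalisation cost (Gysin functoriality `complexGysin_comp`, images of closed sets under proper maps,
Hodge types along `m + 1 = 2q`). -/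
theorem stub_steinFreeTransfer : SteinFreeTransfer := by
  sorry

/-- **STUB 3 — THE TANGENTIAL-CARRIER LAW (XL; OPEN; THE LEVER — hardest and most informative).** WHY PLAUSIBLY
TRUE: (a) the classes obeying it form a `ℚ`-subspace (sum: multiply the admissible forms, take the disjoint union of
the carriers — the fibre products and their singular points add up; a Δ-vertical summand is absorbed), and granted
HC every cycle class `[Z]`, `Z ⊆ X̃` of codimension `q`, obeys it: if `π(Z) ⊆ Δ` the class is Δ-vertical; for
`q = 2` take `S = Z`, `ν = π|_Z` when `π(Z)` is a surface (the fibre product `X̃ ×_{ℙ³} Z` carries the tautological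
section `z ↦ (z,z)` — the card's Mordell–Weil picture — and is singular exactly at the finitely many tangencies of
`π(Z)` with `Δ` and at the `k_Z = Z·[N]` points of `Z ∩ N`; `[N] = 10(π^*h)² - 4π^*h·c₁ + c₂` by Porteous), or a
generic surface through `π(Z)` when it is a curve; for `q ≥ 3` take a resolution `S` of a generic hypersurface of
large degree through the `q`-fold `π(Z) ⊆ ℙ^{2q-1}` (generically singular along a curve in `π(Z)`: the normal
bundle has rank `q - 1 < q = dim`, whence NORMALISED carriers), with isolated characteristic points; calibration: cubic fourfold ⊃
plane `P`, `S = P ≅ π(P)` a plane, `k = 4` nodes, defect `1 = ⟨P⟩`. (b) By stub 4 a class that is not Δ-vertical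
can only become vertical over a NON-generic carrier (`carriersOfNewClasses_not_generic`), and by stub 5 a smooth one
adds nothing — so `k ≥ 1` is forced, and the law says the characteristic locus can always be taken FINITE
(no contact along curves is ever needed: ℚ-factoriality of transversal `A₁`-contact gives no rational defect,
ideator-1 B5). WHY IT MIGHT FAIL: it contains `NetVerticality` (forget the carrier), i.e. middle-degree HC for
curve-fibred `2q`-folds modulo Δ-vertical classes — OPEN from `q = 2`; the structural surplus (finite characteristic
locus on a normalised carrier) fails if some Hodge class is vertical only over carriers with non-isolated contact;
and by the card's own count (expected dimension of defect-carrying tangential carriers `≈ -(g-1)e³/6 < 0`, `q = 2`)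
no Porteous/positivity engine produces the carrier — it exists by Hodge forcing only. The one proposed recipe (the
microlocal degeneracy scheme on `Δ` of the Saito `Gr_F^q`-component of `c`) is not typable in the tree (no
`V`-filtration) and, as a tangency scheme alone, does not determine verticality (the new classes over a carrier
depend on its period geometry — stub 5's `R` — not only on where it touches `Δ`); hence no finer split today.
CHEAPEST FALSIFIER (card (iii); one batched kit job for the lead): a known primitive algebraic class on the Fermat
cubic fourfold / Hassett `C₁₂`, `C₂₀` whose every carrier of degree `≤ deg π(Z)` is non-characteristic, or a nodal
`W_T ⊇ Z` with `σ = 0` although `[Z]` is new. LEANS ON (to state): `Motives.CurveNet`, `CurveNet.IsAdmissibleForm`,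
`classesSupportedOn`, Mathlib `pullback`, `SmoothOfRelativeDimension`, `IsProper`, `IsRegularLocalRing`. -/
theorem stub_tangentialCarrierLaw : TangentialCarrierLaw := by
  sorry

/-- **STUB 4 — generic carriers add nothing (L; TRUE IN PRINT — ideator-1 B5, re-derived independently by triagers
r1-1 and r1-2; tree-blocked).** PROOF IN PRINT (`U₀ = ℙᵐ ∖ V(F₀)` affine, `π` smooth over `U₀` since
`Δ ⊆ V(F₀)`, `V = R¹π_*ℚ|_{U₀}`, `T' = V(G) ∩ U₀`, `G` generic — in particular `V(G)` smooth): by Deligne's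
decomposition for the smooth projective `π|_{U₀}` and Artin vanishing, the restriction of `H^{2q}(X̃)` to
`H^{2q}(π⁻¹U₀)` sits in `H^{2q-1}(U₀, V)` (the `R⁰`-part is `H^{2q}(U₀) = 0`; the `R²`-part is `π_* c|_{U₀} ∈
ℚ·h^{q-1}|_{U₀} = 0`, `q ≥ 2`, CONNECTED fibres used here); the kernel of `H^{2q-1}(U₀, V) → H^{2q-1}(U₀ ∖ T', V)`
is the Gysin image of `H^{2q-3}(T', V)(-1)` (Thom isomorphism for the smooth divisor `T'`); classes from `X̃` have
weight `2q`, so by strictness only `Gysin(W_{2q-2}H^{2q-3}(T', V)) = Gysin(im IH^{m-2}(V(G), IC V))` can meet them;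
for `V(G)` transverse to a Whitney stratification adapted to `IC(V)` (generic `G`: Bertini–Kleiman for the very
ample `|𝒪(e)|`) the Lefschetz hyperplane theorem for perverse sheaves gives `IH^{m-2}(V(G), IC V) ≅
IH^{m-2}(ℙᵐ, IC V)` (`m - 2 ≤ dim V(G) - 1`), and `Gysin ∘ res = e·h ∪ (·)`, which is `0` over `U₀` because
`h|_{U₀} = deg(F₀)⁻¹ [V(F₀)]|_{U₀} = 0`. The good `G` form a non-empty Zariski-open subset of `H⁰(𝒪(e))`, which
contains a non-empty basic open `{Φ ≠ 0}`. WHY IT MIGHT FAIL: as mathematics it should not (Deligne 1968,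
BBD/Goresky–MacPherson Lefschetz for IC, strictness); do NOT strengthen it to generic TRANSLATES of a fixed SINGULAR
carrier (for `q ≥ 3` the singular strata of a moved singular `V(G)` can carry classes of their own). ROLE: the
card's localisation theorem (`carriersOfNewClasses_not_generic`) and the `W'`-input of stub 5. Literature to vendor:
Lefschetz hyperplane for `IC` of a local system (SMT II §6; BBD 4.1), decomposition over the smooth base. -/
theorem stub_genericCarriersAddNothing : GenericCarriersAddNothing := by
  sorry

/-- **STUB 5 — the defect bound for embedded nodal carriers (L; TRUE IN PRINT; tree-blocked on vanishing cycles of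
vertical degenerations).** PROOF IN PRINT: `W = π⁻¹V(G)` `k`-nodal (reduced structure), `A = π⁻¹V(F₀)`. Components of
`V(G)` inside `V(F₀)` can be deleted from `G` without changing either side (both only see supports) and the
remaining nodes are a subset, so assume `π^*V(G)` reduced. Classes supported on `A ∪ W` beyond `A` are read on
`X° = X̃ ∖ A`: `vert(F₀G)/vert(F₀) ↪ im(H^{2q}X̃ → H^{2q}X°) ∩ im(H^{2q}_{W°}(X°))`, and `H^{2q}_{W°}(X°) ≅
H^{BM}_{2q}(W°)`, whose lowest-weight part is the image of `H_{2q}(W̃)`, `W̃` the blow-up of the nodes (Deligne,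
Hodge III 8.2–8.3); the exceptional quadrics map to points of `X̃`, so contribute `0` in degree `2q`; hence the new
classes lie in `vert(F₀) + im(H_{2q}(W) → H_{2q}(X̃))`. For a generic perturbation `G' = G + tG''` (small `t`) the
degeneration `W' = π⁻¹V(G') ⇝ W` is a `k`-ODP degeneration with smooth total space, `W_tube ≃ W' ∪ k` cells
`e^{2q}` glued along the vanishing spheres `S^{2q-1}_i` (Voisin II Thm 2.16 in each Milnor ball), so
`H_{2q}(W)/im H_{2q}(W') ≅ R := ker(ℚᵏ → H_{2q-1}(W'))`, `dim R = σ ≤ k` (Clemens' defect), and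
`im H_{2q}(W') ⊆ vert(F₀·G') = vert(F₀)` by stub 4 (`G'` is generic of degree `e`). So
`finrank vert(F₀G) ≤ finrank vert(F₀) + σ`. `k = 0`: `W ≅ W'` by an isotopy inside `X̃` (Ehresmann for the smooth
pencil), nothing new. WHY IT MIGHT FAIL: only through a non-Lefschetz subtlety of the pencil at a node of the REDUCED
divisor (handled by the reduction step above); the bound `≤ k` (not `≤ σ`) is deliberately crude. CALIBRATION: nodal
cubic threefold `Y = X ∩ ℙ⁴ ⊇ P` in a cubic fourfold, `k = 4`, `σ = 4 - 3 = 1` (card; Marquand–Viktorova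
arXiv:2312.05118 Thm 5: `σ > 0` iff the cubic contains a plane or a cubic scroll). -/
theorem stub_defectNodeBound : DefectNodeBound := by
  sorry

/-! ### §3 Consistency: each named statement IS its registered stub (definitionally) -/

example : OddConiveauOne := stub_oddConiveauOne
example : SteinFreeTransfer := stub_steinFreeTransfer
example : TangentialCarrierLaw := stub_tangentialCarrierLaw
example : GenericCarriersAddNothing := stub_genericCarriersAddNothing
example : DefectNodeBound := stub_defectNodeBound

/-! Name-keyed aliases of the statements (the hypotheses of the composition: the skeleton audit admits a hypothesis
only if its head constant is a registered obligation or is named like a declared stub). -/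
namespace Registered

/-- Alias of `OddConiveauOne` keyed by the registered stub name. -/
abbrev stub_oddConiveauOne : Prop := OddConiveauOne
/-- Alias of `SteinFreeTransfer` keyed by the registered stub name. -/
abbrev stub_steinFreeTransfer : Prop := SteinFreeTransfer
/-- Alias of `TangentialCarrierLaw` keyed by the registered stub name. -/
abbrev stub_tangentialCarrierLaw : Prop := TangentialCarrierLaw
/-- Alias of `GenericCarriersAddNothing` keyed by the registered stub name. -/
abbrev stub_genericCarriersAddNothing : Prop := GenericCarriersAddNothing
/-- Alias of `DefectNodeBound` keyed by the registered stub name. -/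
abbrev stub_defectNodeBound : Prop := DefectNodeBound

end Registered

/-! ### §4 Glue (PROVED) -/

/-! **Necessity of stub 1** (honouring the one landed constraint on the crux): the crux AS TYPED implies
`OddConiveauOne` — this is VERBATIM the landed, kernel-checked
`Summit.HodgeConjecture.HodgeConjecture.Theorems.verticalSupportMiddle_imp_coniveau_one_odd :
VerticalSupportMiddle → ∀ ⦃p⦄ ⦃B⦄, 1 ≤ p → IsSmoothProjective (2p+1) B → ∀ c, IsRationalClass c →
IsOfHodgeType (2p+1) B (2p) p p c → c ∈ supportedClasses B (2p) 1`
(file `Theorems/CurveNetMordellWeilVerticalSupportMiddleHardness.lean`, p103054, registered on the item as the sub-goal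
`verticalSupportMiddle_imp_coniveau_one_odd`; the disconnected-fibre surjection `B × ℙ¹ ⟶ B ⟶ ℙ^{2p+1}` and the
middle-degree class `pr₁^* c ∪ pr₂^* ρ`), i.e. `example : VerticalSupportMiddle → OddConiveauOne :=
Theorems.verticalSupportMiddle_imp_coniveau_one_odd` elaborates against that file. So every proof of the crux proves
stub 1. (The import of that Theorems file is omitted here only to keep this workfile's import closure inside
`Theses/` + `Literature/`.) -/

/-- **The law gives `C⁺`**: forget the structure of the carrier (`F := F₀` or `F := F₀ · G`, non-zero in the domain
`ℂ[x₀,…,xₘ]`). -/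
theorem netVerticality_of_law (h : TangentialCarrierLaw) : NetVerticality := by
  intro q m X N hq hm c hc hh
  obtain ⟨F₀, hF₀, -, hcase⟩ := h N hq hm c hc hh
  rcases hcase with hmem | ⟨G, e, k, -, -, hG0, -, -, hmem⟩
  · exact ⟨F₀, hF₀, hmem⟩
  · exact ⟨F₀ * G, mul_ne_zero hF₀ hG0, hmem⟩

/-- **The line's composition** — the crux `VerticalSupportMiddle` BY NAME from the registered stubs 1–3: the law
gives vertical support on honest nets (`netVerticality_of_law`), the Stein-free transfer (fed with coniveau one on
odd-dimensional varieties) turns it into pointwise vertical support for every surjective `pr`, and every generator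
of the span of rational `(q,q)`-classes then lies in the vertical summand of the crux's conclusion. -/
theorem VerticalSupportMiddle_of (h₁ : Registered.stub_oddConiveauOne) (h₂ : Registered.stub_steinFreeTransfer)
    (h₃ : Registered.stub_tangentialCarrierLaw) :
    Summit.HodgeConjecture.HodgeConjecture.Theses.CurveNetMordellWeil.VerticalSupportMiddle := by
  have hGV : GeneralVerticality := h₂ h₁ (netVerticality_of_law h₃)
  intro q m X pr hX hq hm hsurj
  refine le_sup_of_le_right (Submodule.span_mono ?_)
  rintro c ⟨hc, hh⟩
  exact ⟨hc, hh, hGV pr hX hq hm hsurj c hc hh⟩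

/-- Wiring check: the registered stubs feed `VerticalSupportMiddle_of` as stated. -/
example : Summit.HodgeConjecture.HodgeConjecture.Theses.CurveNetMordellWeil.VerticalSupportMiddle :=
  VerticalSupportMiddle_of stub_oddConiveauOne stub_steinFreeTransfer stub_tangentialCarrierLaw

/-! ### §5 Pay-off of stubs 4–5 (PROVED): the localisation theorem and the defect inequality -/

/-- **Carriers of NEW vertical classes are characteristic** (the card's localisation theorem, from stub 4): for a
curve net, a non-zero admissible `F₀` and a degree `e ≥ 1`, the genericity polynomial `Φ` of stub 4 vanishes at every
degree-`e` form `G` over which some class that is NOT Δ-vertical becomes vertical. In particular the carrier `G` of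
the second branch of the law, whenever it is needed, is never generic. -/
theorem carriersOfNewClasses_not_generic (h : GenericCarriersAddNothing) {q m : ℕ} {X : SchemeOver ℂ}
    (N : CurveNet m X) (hq : 2 ≤ q) (hm : m + 1 = 2 * q) (F₀ : MvPolynomial (Fin (m + 1)) ℂ) (e : ℕ)
    (hadm : N.IsAdmissibleForm F₀) (hF₀ : F₀ ≠ 0) (he : 1 ≤ e) :
    ∃ Φ : MvPolynomial (Fin (m + 1) →₀ ℕ) ℂ,
      (∃ G₀ : MvPolynomial (Fin (m + 1)) ℂ, G₀.IsHomogeneous e ∧ coeffEval Φ G₀ ≠ 0) ∧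
      ∀ G : MvPolynomial (Fin (m + 1)) ℂ, G.IsHomogeneous e →
        ∀ c : complexBetti N.total (2 * q), c ∉ vert N F₀ (2 * q) → c ∈ vert N (F₀ * G) (2 * q) →
          coeffEval Φ G = 0 := by
  obtain ⟨Φ, hΦ, hgen⟩ := h N hq hm F₀ e hadm hF₀ he
  refine ⟨Φ, hΦ, fun G hG c hc hcG => ?_⟩
  by_contra hne
  exact hc ((hgen G hG hne) ▸ hcG)

/-- **Smooth vertical divisors add nothing** (stub 5 at `k = 0`): if `π⁻¹V(G)` underlies a SMOOTH (`0`-nodal)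
divisor of `X̃`, then `vert(F₀·G) = vert(F₀)` — the finite-dimensional sandwich `vert(F₀) ≤ vert(F₀G)`,
`finrank vert(F₀G) ≤ finrank vert(F₀)`. -/
theorem vert_mul_eq_of_smooth_carrier (h : DefectNodeBound) {q m : ℕ} {X : SchemeOver ℂ} (N : CurveNet m X)
    (hq : 2 ≤ q) (hm : m + 1 = 2 * q) (F₀ G : MvPolynomial (Fin (m + 1)) ℂ) (e : ℕ)
    (hadm : N.IsAdmissibleForm F₀) (hF₀ : F₀ ≠ 0) (he : 1 ≤ e) (hG : G.IsHomogeneous e)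
    (hsmooth : IsNodalCarrier N G 0) : vert N (F₀ * G) (2 * q) = vert N F₀ (2 * q) := by
  haveI : Module.Finite ℂ (complexBetti N.total (2 * q)) := finite_complexBetti N.isSmoothProjective_total (2 * q)
  have hfin := h N hq hm F₀ G e 0 hadm hF₀ he hG hsmooth
  rw [add_zero] at hfin
  exact (Submodule.eq_of_le_of_finrank_le (vert_le_vert_mul N F₀ G (2 * q)) hfin).symm

/-- **The new-class budget of an embedded nodal carrier** (stub 5 rephrased as the card's defect inequality
`σ ≤ k`): the vertical classes over `V(F₀·G)` modulo those over `V(F₀)` form a space of dimension at most the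
number `k` of nodes of `π⁻¹V(G)`. -/
theorem finrank_newVertical_le (h : DefectNodeBound) {q m : ℕ} {X : SchemeOver ℂ} (N : CurveNet m X)
    (hq : 2 ≤ q) (hm : m + 1 = 2 * q) (F₀ G : MvPolynomial (Fin (m + 1)) ℂ) (e k : ℕ)
    (hadm : N.IsAdmissibleForm F₀) (hF₀ : F₀ ≠ 0) (he : 1 ≤ e) (hG : G.IsHomogeneous e)
    (hnodal : IsNodalCarrier N G k) :
    Module.finrank ℂ (↥(vert N (F₀ * G) (2 * q)) ⧸
        (vert N F₀ (2 * q)).comap (vert N (F₀ * G) (2 * q)).subtype) ≤ k := by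
  haveI : Module.Finite ℂ (complexBetti N.total (2 * q)) := finite_complexBetti N.isSmoothProjective_total (2 * q)
  have hfin := h N hq hm F₀ G e k hadm hF₀ he hG hnodal
  have hle := vert_le_vert_mul N F₀ G (2 * q)
  -- the comap of the smaller space into the bigger one is a copy of the smaller space
  have hC : Module.finrank ℂ ↥((vert N F₀ (2 * q)).comap (vert N (F₀ * G) (2 * q)).subtype) =
      Module.finrank ℂ ↥(vert N F₀ (2 * q)) :=
    LinearEquiv.finrank_eq (Submodule.comapSubtypeEquivOfLe hle)
  have hsum := Submodule.finrank_quotient_add_finrank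
    ((vert N F₀ (2 * q)).comap (vert N (F₀ * G) (2 * q)).subtype)
  omega

/-! ### §6 Lead a1 (2026-08-16): the lever IS `C⁺`, and the crux contains `C⁺` — kernel-checked

Landed as `Theorems/CurveNetMordellWeilVerticalSupportMiddleLever.lean` (`--supports` stmt-HodgeConjecture-2782):
`Theorems.curveNet_deltaVertical_of_vertical` (every class supported on `π⁻¹V(F)`, `F ≠ 0`, is supported on
`π⁻¹V(F₀)` for a non-zero ADMISSIBLE `F₀`: `V(F) ∪ Δ` is a proper closed subset of the irreducible `ℙᵐ` by generic
smoothness, hence lies on a hypersurface through `Δ`) and `Theorems.verticalSupportMiddle_imp_netVerticality`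
(the crux applied to the net's own projection; the algebraic summand is vertical for `q ≥ 2` by the codimension of
images). Consequences for this line, proved below: the law's tangential-carrier branch is NEVER exercised —
`TangentialCarrierLaw ↔ NetVerticality` — and the crux implies the lever it is meant to be proved from. With the
hardness theorem (`Theorems.verticalSupportMiddle_imp_coniveau_one_odd`: crux ⟹ stub 1) the crux as typed is
`OddConiveauOne ∧ NetVerticality` modulo the transfer (stub 2, landed modulo `DeligneDescent` as
`Theorems.steinFreeTransfer_of_deligneDescent`, p110919), and the lever is the `NetVerticality` half of the
crux: the line carries the crux in carrier clothes (cf. dead line `Sketch`: detection ⟺ crux). -/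

/-! #### Local copies of the landed lever lemmas
The six lemmas below are VERBATIM the declarations of the landed `Theorems/CurveNetMordellWeilVerticalSupportMiddleLever.lean`
(p109304, namespace `Summit.HodgeConjecture.HodgeConjecture.Theorems`), re-declared in this workfile's namespace only because
Cruxes workfiles are elaborated against the farm snapshot, which does not yet contain that module; delete this block and
`open Summit.HodgeConjecture.HodgeConjecture.Theorems` once it is built. -/
section LeverLocalCopies

variable {m : ℕ} {X : SchemeOver ℂ}

/-- **Two proper Zariski-closed subsets of `ℙᵐ_ℂ` do not cover it** (`ℙᵐ` is irreducible: the tree's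
`isSmoothProjective_projectiveSpace_holds` + `IsSmoothProjective.isIntegral_holds`). -/
theorem projectiveSpace_union_ne_univ (m : ℕ) {T₁ T₂ : Set (projectiveSpace m ℂ).left} (h₁ : IsClosed T₁)
    (h₂ : IsClosed T₂) (h₁' : T₁ ≠ Set.univ) (h₂' : T₂ ≠ Set.univ) : T₁ ∪ T₂ ≠ Set.univ := by
  haveI : IsIntegral (projectiveSpace m ℂ).left :=
    IsSmoothProjective.isIntegral_holds (isSmoothProjective_projectiveSpace_holds ℂ m)
  intro h
  rcases (isPreirreducible_iff_isClosed_union_isClosed.mp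
      (PreirreducibleSpace.isPreirreducible_univ (X := ↥(projectiveSpace m ℂ).left)) T₁ T₂ h₁ h₂ h.symm.le)
    with hle | hle
  · exact h₁' (Set.eq_univ_of_univ_subset hle)
  · exact h₂' (Set.eq_univ_of_univ_subset hle)

/-- **Over `ℂ` the discriminant of a curve net is a proper closed subset of `ℙᵐ`** (generic smoothness, through the
tree's `FiberNet.discriminant_ne_univ_of_charZero` and `curveNetEquivFiberNet`). -/
theorem curveNet_discriminant_ne_univ (N : CurveNet m X) : N.discriminant ≠ Set.univ := by
  rw [← FiberNet.discriminant_toFiberNet]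
  exact N.toFiberNet.discriminant_ne_univ_of_charZero

/-- **Every proper closed `T ⊊ ℙᵐ` lies on a non-zero ADMISSIBLE hypersurface of the net**: there is a form
`F₀ ≠ 0`, homogeneous of degree `≥ 1`, with `Δ ⊆ V(F₀)` (`N.IsAdmissibleForm F₀`) and `T ⊆ V(F₀)` — apply
`exists_form_of_isClosed_of_ne_univ` to the proper closed `T ∪ Δ`. -/
theorem curveNet_exists_isAdmissibleForm_supset (N : CurveNet m X) {T : Set (projectiveSpace m ℂ).left}
    (hT : IsClosed T) (hTne : T ≠ Set.univ) :
    ∃ F₀ : MvPolynomial (Fin (m + 1)) ℂ, F₀ ≠ 0 ∧ N.IsAdmissibleForm F₀ ∧ T ⊆ projHypersurface m F₀ := by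
  obtain ⟨F, e, he, hFe, hF0, hsub⟩ := exists_form_of_isClosed_of_ne_univ m (hT.union N.isClosed_discriminant)
    (projectiveSpace_union_ne_univ m hT N.isClosed_discriminant hTne (curveNet_discriminant_ne_univ N))
  exact ⟨F, hF0, ⟨⟨e, he, hFe⟩, Set.subset_union_right.trans hsub⟩, Set.subset_union_left.trans hsub⟩

/-- **Every vertical class is Δ-vertical in the lever's sense.** If a class `c ∈ Hᵏ(X̃(ℂ); ℂ)` is supported on
`π⁻¹V(F)` for some polynomial `F ≠ 0`, then it is supported on `π⁻¹V(F₀)` for a NON-ZERO ADMISSIBLE form `F₀`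
(`Δ ⊆ V(F₀)`): take `V(F₀) ⊇ V(F) ∪ Δ`. Consequently the first branch of the line's `TangentialCarrierLaw`
absorbs every class that `NetVerticality` makes vertical, and the law's tangential-carrier branch is never
exercised: `TangentialCarrierLaw ↔ NetVerticality`. -/
theorem curveNet_deltaVertical_of_vertical :
    ∀ {m : ℕ} {X : SchemeOver ℂ} (N : CurveNet m X) {F : MvPolynomial (Fin (m + 1)) ℂ}, F ≠ 0 →
      ∀ {k : ℕ} {c : complexBetti N.total k},
        c ∈ classesSupportedOn N.total (N.proj.left.base ⁻¹' projHypersurface m F) k →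
          ∃ F₀ : MvPolynomial (Fin (m + 1)) ℂ, F₀ ≠ 0 ∧ N.IsAdmissibleForm F₀ ∧
            c ∈ classesSupportedOn N.total (N.proj.left.base ⁻¹' projHypersurface m F₀) k := by
  intro m X N F hF k c hc
  obtain ⟨F₀, hF₀, hadm, hsub⟩ := curveNet_exists_isAdmissibleForm_supset N (isClosed_projHypersurface m F)
    (projHypersurface_ne_univ m hF)
  exact ⟨F₀, hF₀, hadm, classesSupportedOn_mono (Set.preimage_mono hsub) k hc⟩

/-- **The image under `π` of a closed subset of codimension `≥ q` of the total space is a proper closed subset of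
`ℙᵐ`** (`m + 1 = 2q`, `q ≥ 2`): `π` is proper hence closed, and its points have codimension `≥ q - 1 ≥ 1`
(`le_coheight_of_mem_image`), whereas the generic point of `ℙᵐ` has codimension `0`. -/
theorem curveNet_image_proj_ne_univ (N : CurveNet m X) {q : ℕ} (hq : 2 ≤ q) (hm : m + 1 = 2 * q)
    {Z : Set N.total.left} (hZ : IsClosed Z) (hcoh : ∀ z ∈ Z, (q : ℕ∞) ≤ Order.coheight z) :
    IsClosed (N.proj.left.base '' Z) ∧ N.proj.left.base '' Z ≠ Set.univ := by
  have hcl : IsClosedMap N.proj.left.base := by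
    haveI := N.isProper_proj
    exact N.proj.left.isClosedMap
  refine ⟨hcl _ hZ, fun h => ?_⟩
  haveI : IsIntegral (projectiveSpace m ℂ).left :=
    IsSmoothProjective.isIntegral_holds (isSmoothProjective_projectiveSpace_holds ℂ m)
  have hη : genericPoint (projectiveSpace m ℂ).left ∈ N.proj.left.base '' Z := h ▸ Set.mem_univ _
  have h1 : ((1 : ℕ) : ℕ∞) ≤ Order.coheight (genericPoint (projectiveSpace m ℂ).left) :=
    le_coheight_of_mem_image N.isSmoothProjective_total (isSmoothProjective_projectiveSpace_holds ℂ m) N.proj hcl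
      hcoh (by omega) hη
  have h0 : Order.coheight (genericPoint (projectiveSpace m ℂ).left) = 0 :=
    Order.coheight_eq_zero.2 fun y _ ↦ Scheme.le_iff_specializes.2 (genericPoint_specializes y)
  rw [h0] at h1
  exact absurd h1 (by norm_num)

/-- **The crux AS TYPED contains `C⁺` (`NetVerticality`) verbatim.** Apply `VerticalSupportMiddle` to the net's
own (surjective) projection `π : X̃ ⟶ ℙᵐ` on the smooth projective `2q`-fold `X̃ = N.total`: a rational
`(q,q)`-class `c` lies in `algebraicClasses X̃ q ⊔ span{classes dying off π⁻¹T, T ⊊ ℙᵐ closed}`; the classes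
dying off `π⁻¹T` for SOME proper closed `T` form a submodule (finite unions of proper closed subsets of the
irreducible `ℙᵐ` are proper), which contains the second summand by definition and the first because a class
supported on a closed `Z` of codimension `≥ q` dies off `π⁻¹(π Z)` with `π Z ⊊ ℙᵐ` proper closed
(`curveNet_image_proj_ne_univ`); finally a proper closed `T` lies on a hypersurface `V(F)`, `F ≠ 0`. -/
theorem verticalSupportMiddle_imp_netVerticality :
    VerticalSupportMiddle → ∀ ⦃q m : ℕ⦄ ⦃X : SchemeOver ℂ⦄ (N : CurveNet m X), 2 ≤ q → m + 1 = 2 * q →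
      ∀ c : complexBetti N.total (2 * q), IsRationalClass c → IsOfHodgeType (m + 1) N.total (2 * q) q q c →
        ∃ F : MvPolynomial (Fin (m + 1)) ℂ, F ≠ 0 ∧
          c ∈ classesSupportedOn N.total (N.proj.left.base ⁻¹' projHypersurface m F) (2 * q) := by
  intro h q m X N hq hm c hc hh
  -- the submodule of classes vertical over SOME proper closed subset of the base
  let S : Submodule ℂ (complexBetti N.total (2 * q)) :=
    { carrier := {x | ∃ T : Set (projectiveSpace m ℂ).left, IsClosed T ∧ T ≠ Set.univ ∧
          x ∈ classesSupportedOn N.total (N.proj.left.base ⁻¹' T) (2 * q)}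
      zero_mem' := by
        haveI := N.nonempty_base
        exact ⟨∅, isClosed_empty, Set.empty_ne_univ, Submodule.zero_mem _⟩
      add_mem' := by
        rintro a b ⟨T₁, hT₁, hT₁', ha⟩ ⟨T₂, hT₂, hT₂', hb⟩
        refine ⟨T₁ ∪ T₂, hT₁.union hT₂, projectiveSpace_union_ne_univ m hT₁ hT₂ hT₁' hT₂', ?_⟩
        exact Submodule.add_mem _
          (classesSupportedOn_mono (Set.preimage_mono Set.subset_union_left) _ ha)
          (classesSupportedOn_mono (Set.preimage_mono Set.subset_union_right) _ hb)
      smul_mem' := by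
        rintro t a ⟨T, hT, hT', ha⟩
        exact ⟨T, hT, hT', Submodule.smul_mem _ t ha⟩ }
  have hX2 : IsSmoothProjective (2 * q) N.total := by
    rw [← hm]
    exact N.isSmoothProjective_total
  have hh2 : IsOfHodgeType (2 * q) N.total (2 * q) q q c := by
    convert hh using 1
    exact hm.symm
  have hcmem := h N.proj hX2 hq hm N.surjective_proj (Submodule.subset_span ⟨hc, hh2⟩)
  -- the algebraic summand is vertical
  have h1 : algebraicClasses N.total q ≤ S := by
    refine iSup_le fun Z => iSup_le fun hZ => iSup_le fun hcoh => ?_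
    intro x hx
    obtain ⟨hcl, hne⟩ := curveNet_image_proj_ne_univ N hq hm hZ hcoh
    refine ⟨N.proj.left.base '' Z, hcl, hne, ?_⟩
    exact classesSupportedOn_mono (Set.subset_preimage_image _ Z) _ hx
  -- the vertical summand is vertical
  have h2 : Submodule.span ℂ {c : complexBetti N.total (2 * q) | IsRationalClass c ∧
      IsOfHodgeType (2 * q) N.total (2 * q) q q c ∧ ∃ T : Set (projectiveSpace m ℂ).left,
        IsClosed T ∧ T ≠ Set.univ ∧ complexBetti.restrictCompl N.total (N.proj.left.base ⁻¹' T) (2 * q) c = 0}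
      ≤ S := by
    refine Submodule.span_le.2 ?_
    rintro x ⟨-, -, T, hT, hTne, hx⟩
    exact ⟨T, hT, hTne, mem_classesSupportedOn_iff.2 hx⟩
  obtain ⟨T, hT, hTne, hcT⟩ := (sup_le h1 h2) hcmem
  obtain ⟨F, e, -, -, hF0, hsub⟩ := exists_form_of_isClosed_of_ne_univ m hT hTne
  exact ⟨F, hF0, classesSupportedOn_mono (Set.preimage_mono hsub) _ hcT⟩

end LeverLocalCopies

/-- **Every vertical class is Δ-vertical; the law's carrier branch is never exercised**:
`NetVerticality → TangentialCarrierLaw` (first disjunct always, with `F₀ ⊇ V(F) ∪ Δ` from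
`Theorems.curveNet_deltaVertical_of_vertical`). -/
theorem law_of_netVerticality (h : NetVerticality) : TangentialCarrierLaw := by
  intro q m X N hq hm c hc hh
  obtain ⟨F, hF, hcF⟩ := h N hq hm c hc hh
  obtain ⟨F₀, hF₀, hadm, hc₀⟩ := curveNet_deltaVertical_of_vertical N hF hcF
  exact ⟨F₀, hF₀, hadm, Or.inl hc₀⟩

/-- **The lever is `C⁺` verbatim**: `TangentialCarrierLaw ↔ NetVerticality`. -/
theorem tangentialCarrierLaw_iff_netVerticality : TangentialCarrierLaw ↔ NetVerticality :=
  ⟨netVerticality_of_law, law_of_netVerticality⟩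

/-- **The crux contains `C⁺`**: `VerticalSupportMiddle → NetVerticality`
(`Theorems.verticalSupportMiddle_imp_netVerticality`, statement verbatim `NetVerticality`). -/
theorem netVerticality_of_crux (h : VerticalSupportMiddle) : NetVerticality :=
  verticalSupportMiddle_imp_netVerticality h

/-- **The crux implies the lever it is to be proved from**: `VerticalSupportMiddle → TangentialCarrierLaw`. -/
theorem law_of_crux (h : VerticalSupportMiddle) : TangentialCarrierLaw :=
  law_of_netVerticality (netVerticality_of_crux h)

/-- **What the line reduces to.** Granted `hH : crux → stub 1` (the LANDED hardness theorem
`Theorems.verticalSupportMiddle_imp_coniveau_one_odd`, p103054 — taken as a hypothesis only because its module is being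
rebuilt on the farm) and the transfer (stub 2; LANDED modulo the route item `DeligneDescent` as
`Theorems.steinFreeTransfer_of_deligneDescent`, p110919), the crux AS TYPED is equivalent to the conjunction of stub 1
(`OddConiveauOne`, the Stein artefact = HC(q-1) on odd-dimensional varieties modulo coniveau) and the lever
`TangentialCarrierLaw` (= `C⁺ = NetVerticality`, middle-degree HC on curve-fibred `2q`-folds modulo nothing; and by
`Theorems.netVerticality_iff_hodge_middle`, p110710, = HC^q on ALL smooth projective `2q`-folds modulo descent and the
lower codimensions). No stub of the line is smaller than the half of the crux it stands for. -/
theorem crux_iff_of_transfer (hH : VerticalSupportMiddle → OddConiveauOne) (h₂ : SteinFreeTransfer) :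
    VerticalSupportMiddle ↔ (OddConiveauOne ∧ TangentialCarrierLaw) :=
  ⟨fun h => ⟨hH h, law_of_crux h⟩, fun h => VerticalSupportMiddle_of h.1 h₂ h.2⟩

end Summit.HodgeConjecture.HodgeConjecture.Cruxes.VerticalSupportMiddle.TangentialCarriersPeriodSyzygies

end
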